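import Literature.AlgebraicGeometry.Resolution.SeparablyDefectlessRationalVTProofs
import Literature.AlgebraicGeometry.Resolution.GeneralizedStabilityAlgClosedHolds
import HarnessLib

/-!
# Kuhlmann 2010, Thm. 1.1, "separably defectless" clause for `K(x)`, `x` value-transcendental over a separably closed `K`: discharge

Topic: `Literature/AlgebraicGeometry/Resolution` (valued function fields). DISCHARGE of the named
fact `Kuhlmann2010SeparablyDefectlessRational_sepClosed` (`Kuhlmann2019HenselianRationalitySteps.lean`)
= F.-V. Kuhlmann, *Elimination of ramification I: The generalized stability theorem*, Trans.
Amer. Math. Soc. 362 (2010) 5697–5727 = arXiv:1003.5678, **Thm. 1.1, the "separably defectless"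
clause** ("If `vK` is cofinal in `vF`, then it also holds for 'separably defectless' in the place
of 'defectless'") for `F = K(x)` with `x` value-transcendental over a separably closed `K` — the
form quoted by Kuhlmann 2019, proof of Prop. 5.7 ("According to [16, Theorem 1], `(K₀(x),v)` is a
separably defectless field"), one of the three leaves of the decomposition of Knaf–Kuhlmann 2009,
Thm. 3.8 / Prop. 3.10 (`KnafKuhlmann2009Leaves.lean`).

`SeparablyDefectlessRationalVTProofs.lean` reduced the fact, along the printed proof (§5, p. 20,
with the completion `K^c` replaced by the algebraic closure of `K`, in which the separably closed
`K` is dense), to (R2) for `K'(x)` over the algebraically closed `K'`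
(`Kuhlmann2010SeparablyDefectlessRational_sepClosed.of_algClosedVT`), which is discharged in
`GeneralizedStabilityAlgClosedHolds.lean` (`Kuhlmann2010StabilityAlgClosedValueTranscendental_holds`:
Lemmas 5.2–5.4 and the two rank-one cases of (R4), all proved). This file applies the one to the
other. No definitions, no new named facts.

## Sources

* F.-V. Kuhlmann, *Elimination of ramification I: The generalized stability theorem*, Trans.
  Amer. Math. Soc. 362 (2010) 5697–5727 = arXiv:1003.5678: Thm. 1.1, §5 (Lemmas 5.2–5.4 and
  p. 20). [Kuhlmann2010]
* F.-V. Kuhlmann, *Elimination of ramification II: Henselian rationality*, Israel J. Math. 234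
  (2019) = arXiv:1701.05508: proof of Prop. 5.7 (the use). [Kuhlmann2019]
-/

namespace Literature.AlgebraicGeometry.Resolution

universe u

/-- **DISCHARGE of `Kuhlmann2010SeparablyDefectlessRational_sepClosed`** (Kuhlmann 2010, Thm. 1.1,
"separably defectless" clause, for `K(x)` with `x` value-transcendental over a separably closed
`K` and `vK` cofinal in `vK(x)`): `Kuhlmann2010SeparablyDefectlessRational_sepClosed.of_algClosedVT`
(density of `K(x)` in `K̃(x)`, descent of separable defectlessness along dense purely inseparable
extensions) applied to (R2) for `K̃(x)` (`Kuhlmann2010StabilityAlgClosedValueTranscendental_holds`).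
PROVED. [cite: Kuhlmann2010, Thm. 1.1 (with Section 5, p. 20 and Lemmas 5.2–5.4)] -/
theorem Kuhlmann2010SeparablyDefectlessRational_sepClosed_holds :
    Kuhlmann2010SeparablyDefectlessRational_sepClosed.{u} :=
  Kuhlmann2010SeparablyDefectlessRational_sepClosed.of_algClosedVT
    Kuhlmann2010StabilityAlgClosedValueTranscendental_holds

end Literature.AlgebraicGeometry.Resolution
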